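import Literature.NumberTheory.LFunctions.WeilTwoPrimeCertificateDeflatedSector
import Literature.NumberTheory.LFunctions.WeilTwoPrimeCertificateMargin
import Literature.NumberTheory.LFunctions.WeilDeflationPenaltyPoly
import HarnessLib

/-!
# RiemannHypothesis / GroundBarta — rung 4 (`EvenWinsBeyondArch`, stmt-RiemannHypothesis-18807 / 18085):
# sector split of a COMBINED (both-parity) rank-one augmented two-prime certificate

Helper file (`--supports stmt-RiemannHypothesis-18085`), RH-free, no definitions, no named facts.  Prover A (g10 of unit
`sr-gb-rung-a`), endpoint cell `(log 5)/2`.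

The endpoint cell certifies BOTH parity blocks of the deflated Temple L-side with ONE two-prime certificate whose penalty
data is the concatenation `R = RE ++ RO` of the even penalties (`r.2.1 % 2 = 0`) and the odd ones (`r.2.1 % 2 = 1`), and
whose conclusion (`WeilCert23.weilTwoPrimeQuadratic_rankOne_bound_of_cellsOK`, `checkROK`) holds for EVERY test function:
`β‖g‖² ≤ E₂₃(g) + Σ_{r ∈ RE ++ RO} μ_r |Σ_k ĉ_{rk} M_k(g)|²`.  The sector bridges (`dt_weil{Even,Odd}GroundEnergy_ge_of_deflCert_*`)
want the bound with the penalties of ONE parity and a test of that parity.  Since `ĉ_{rk} = maskV r k` vanishes off the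
parity class of `r` and the moments `M_k(g)` of the other parity class vanish for a test of pure parity
(`weilMoment_odd_of_even`, `weilMoment_even_of_odd`), the other block's rank-one terms are zero:

* `dt_rankOne_listSum_eq_zero_of_even` / `…_of_odd` — the odd (even) penalties contribute `0` on even (odd) tests;
* `dt_deflBound_even_of_append` / `dt_deflBound_odd_of_append` — the sector forms of the combined bound.
-/

set_option linter.dupNamespace false

noncomputable section

open MeasureTheory Set
open scoped BigOperators

namespace Summit.RiemannHypothesis.RiemannHypothesis.Theorems.EvenWinsBeyondArch

open Literature.NumberTheory.LFunctions

/-- On an EVEN test, the rank-one terms of ODD penalties vanish. [folklore] -/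
theorem dt_rankOne_listSum_eq_zero_of_even {φ : ℝ → ℂ} (heven : ∀ x, φ (-x) = φ x) (n : ℕ) (a₀ : ℝ)
    (RO : List (ℚ × ℕ × List ℚ)) (hRO : ∀ r ∈ RO, r.2.1 % 2 = 1) :
    (RO.map fun r ↦ (r.1 : ℝ) * ‖∑ k ∈ Finset.range n, ((maskV r k : ℚ) : ℂ) * weilMoment a₀ φ k‖ ^ 2).sum = 0 := by
  refine List.sum_eq_zero fun x hx ↦ ?_
  obtain ⟨r, hr, rfl⟩ := List.mem_map.1 hx
  have hsum : (∑ k ∈ Finset.range n, ((maskV r k : ℚ) : ℂ) * weilMoment a₀ φ k) = 0 := by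
    refine Finset.sum_eq_zero fun k _ ↦ ?_
    by_cases hk : k % 2 = r.2.1 % 2
    · have hodd : Odd k := Nat.odd_iff.2 (hk.trans (hRO r hr))
      rw [weilMoment_odd_of_even heven a₀ hodd, mul_zero]
    · rw [maskV_eq_zero_of_mod_ne r hk]; push_cast; ring
  rw [hsum, norm_zero]; ring

/-- On an ODD test, the rank-one terms of EVEN penalties vanish. [folklore] -/
theorem dt_rankOne_listSum_eq_zero_of_odd {φ : ℝ → ℂ} (hodd : ∀ x, φ (-x) = -φ x) (n : ℕ) (a₀ : ℝ)
    (RE : List (ℚ × ℕ × List ℚ)) (hRE : ∀ r ∈ RE, r.2.1 % 2 = 0) :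
    (RE.map fun r ↦ (r.1 : ℝ) * ‖∑ k ∈ Finset.range n, ((maskV r k : ℚ) : ℂ) * weilMoment a₀ φ k‖ ^ 2).sum = 0 := by
  refine List.sum_eq_zero fun x hx ↦ ?_
  obtain ⟨r, hr, rfl⟩ := List.mem_map.1 hx
  have hsum : (∑ k ∈ Finset.range n, ((maskV r k : ℚ) : ℂ) * weilMoment a₀ φ k) = 0 := by
    refine Finset.sum_eq_zero fun k _ ↦ ?_
    by_cases hk : k % 2 = r.2.1 % 2
    · have hev : Even k := Nat.even_iff.2 (hk.trans (hRE r hr))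
      rw [weilMoment_even_of_odd hodd a₀ hev, mul_zero]
    · rw [maskV_eq_zero_of_mod_ne r hk]; push_cast; ring
  rw [hsum, norm_zero]; ring

/-- **Even sector of a combined certificate bound**: with `R = RE ++ RO` (`RO` odd penalties) and an even test, the
bound holds with the even penalties alone. [folklore] -/
theorem dt_deflBound_even_of_append {φ : ℝ → ℂ} (heven : ∀ x, φ (-x) = φ x) (n : ℕ) (a₀ : ℝ)
    (RE RO : List (ℚ × ℕ × List ℚ)) (hRO : ∀ r ∈ RO, r.2.1 % 2 = 1) {β N E : ℝ}
    (h : β * N ≤ E + ((RE ++ RO).map fun r ↦ (r.1 : ℝ) *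
      ‖∑ k ∈ Finset.range n, ((maskV r k : ℚ) : ℂ) * weilMoment a₀ φ k‖ ^ 2).sum) :
    β * N ≤ E + (RE.map fun r ↦ (r.1 : ℝ) * ‖∑ k ∈ Finset.range n, ((maskV r k : ℚ) : ℂ) * weilMoment a₀ φ k‖ ^ 2).sum := by
  rw [List.map_append, List.sum_append, dt_rankOne_listSum_eq_zero_of_even heven n a₀ RO hRO, add_zero] at h
  exact h

/-- **Odd sector of a combined certificate bound**: with `R = RE ++ RO` (`RE` even penalties) and an odd test, the
bound holds with the odd penalties alone. [folklore] -/
theorem dt_deflBound_odd_of_append {φ : ℝ → ℂ} (hodd : ∀ x, φ (-x) = -φ x) (n : ℕ) (a₀ : ℝ)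
    (RE RO : List (ℚ × ℕ × List ℚ)) (hRE : ∀ r ∈ RE, r.2.1 % 2 = 0) {β N E : ℝ}
    (h : β * N ≤ E + ((RE ++ RO).map fun r ↦ (r.1 : ℝ) *
      ‖∑ k ∈ Finset.range n, ((maskV r k : ℚ) : ℂ) * weilMoment a₀ φ k‖ ^ 2).sum) :
    β * N ≤ E + (RO.map fun r ↦ (r.1 : ℝ) * ‖∑ k ∈ Finset.range n, ((maskV r k : ℚ) : ℂ) * weilMoment a₀ φ k‖ ^ 2).sum := by
  rw [List.map_append, List.sum_append, dt_rankOne_listSum_eq_zero_of_odd hodd n a₀ RE hRE, zero_add] at h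
  exact h

end Summit.RiemannHypothesis.RiemannHypothesis.Theorems.EvenWinsBeyondArch

end
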